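import Summits.Ventures.PercRepro.PuncturedLYMTwoCoHypGenCols

/-!
# PercRepro — TWO CO-HYPERPLANES OF ANY INTERSECTION, PART 5: THE CORNER COLUMNS AND THE COLUMN IDENTITY ON EVERY
PROFILE (p10, gen 35)

Arithmetic only, continuing part 4.
* `gBeta_corner` — at the corner (`#A + #B + s = j + 2`) the `+B` correction of the row `(#A − 1, #B − 2, s)` is
  `−gErr (#B − 1)/m₁/(n − j − 2)`: the column identity of `C₂` at `m₂ − 1` and its row identity at `m₂ − 2`;
* `col_corner3` — the corner column `(#A − 1, #B − 1, s)` sums to `twoK`; `col_corner3_three` — the same column when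
  `#A + #B + s = j + 3` (both corrections vanish); `col_typeII_end` — the column `(#A, #B, s − 1)` (`#A + #B + s = j + 2`);
* **`w3_col`** — every realisable untouched column sums to `twoK`;  **`w3_top₁`** / **`w3_top₂`** — the touched columns.
Nothing here asserts (SP).
-/

namespace PercRepro.PuncturedLYM

open Finset

/-- `gBeta b = 0` when `j + 1 ≤ m₁ + b`. -/
theorem gBeta_eq_zero {n j m₁ m₂ s b : ℕ} (h : j + 1 ≤ m₁ + b) : gBeta n j m₁ m₂ s b = 0 := by
  unfold gBeta
  rw [show j + 1 - m₁ - b = 0 by omega]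
  simp

/-- **At the corner** (`m₁ + m₂ − s = j + 2`, `s + 2 ≤ m₂`): `(#B − 1)·gBeta (#B − 2) = −gErr (#B − 1)/(m₁·(n − j − 2))`. -/
theorem gBeta_corner {n j m₁ m₂ s : ℕ} (hm₁ : 1 ≤ m₁) (hm₁j : m₁ ≤ j) (hm₂j : m₂ ≤ j) (hn : 2 * j + 1 ≤ n)
    (hs₁ : s ≤ m₁) (hs₂ : s + 2 ≤ m₂) (hsum : m₁ + m₂ - s = j + 2) :
    ((m₂ - s - 1 : ℕ) : ℚ) * gBeta n j m₁ m₂ s (m₂ - s - 2) =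
      -gErr n j m₁ m₂ s (m₂ - s - 1) / (m₁ : ℚ) / ((n : ℚ) - j - 2) := by
  have hr : (0 : ℚ) < ((n - j : ℕ) : ℚ) := by
    have : 1 ≤ n - j := by omega
    exact_mod_cast this
  have hrq : ((n - j : ℕ) : ℚ) = (n : ℚ) - j := by rw [Nat.cast_sub (by omega)]
  have hm : (0 : ℚ) < (m₁ : ℚ) := by exact_mod_cast hm₁
  have hr2 : (n : ℚ) - j - 2 ≠ 0 := by
    have : (j : ℚ) + 3 ≤ n := by exact_mod_cast (show j + 3 ≤ n by omega)
    linarith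
  have herr := gErr_eq (m₂ := m₂) (b := m₂ - s - 1) hm₁ hm₁j hn hs₁
  have e1 : m₂ - s - 1 + s = m₂ - 1 := by omega
  have e2 : m₂ - 1 - 1 = m₂ - 2 := by omega
  rw [e1, e2] at herr
  have hcol := coF_col (m := m₂) (c' := m₂ - 1) (by omega) hm₂j hn (by omega) (by omega)
  have hrow := coF_row (m := m₂) (c := m₂ - 2) (by omega) hm₂j hn (by omega)
  have e3 : m₂ - 1 - 1 = m₂ - 2 := by omega
  rw [e3] at hcol
  have c1 : ((m₂ - 1 : ℕ) : ℚ) = (m₂ : ℚ) - 1 := by rw [Nat.cast_sub (by omega)]; push_cast; ring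
  have c2 : ((m₂ - 2 : ℕ) : ℚ) = (m₂ : ℚ) - 2 := by rw [Nat.cast_sub (by omega)]; push_cast; ring
  rw [c1] at hcol
  rw [c2] at hrow
  have hA : ((m₁ - s : ℕ) : ℚ) = (m₁ : ℚ) - s := by rw [Nat.cast_sub hs₁]
  have hAj : (j : ℚ) + 1 - ((m₂ : ℚ) - 1) = (m₁ : ℚ) - s := by
    have : ((m₁ + m₂ - s : ℕ) : ℚ) = (j : ℚ) + 2 := by exact_mod_cast hsum
    rw [Nat.cast_sub (by omega)] at this
    push_cast at this
    linarith
  rw [hAj] at hcol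
  -- `(n − j)·gErr = −(#B − 1)·g_{m₂−2}`, `2·g_{m₂−2} = (n − j − 2)·f_{m₂−2}`
  have hg : ((n - j : ℕ) : ℚ) * gErr n j m₁ m₂ s (m₂ - s - 1) = -(((m₂ : ℚ) - s - 1) * coG n j m₂ (m₂ - 2)) := by
    rw [herr, hA]
    linear_combination hcol
  have hgE : gErr n j m₁ m₂ s (m₂ - s - 1) = -(((m₂ : ℚ) - s - 1) * coG n j m₂ (m₂ - 2)) / ((n - j : ℕ) : ℚ) := by
    rw [eq_div_iff hr.ne']
    linear_combination hg
  have hgf : coG n j m₂ (m₂ - 2) = ((n : ℚ) - j - 2) * coF n j m₂ (m₂ - 2) / 2 := by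
    rw [eq_div_iff (by norm_num)]
    linear_combination hrow
  unfold gBeta
  rw [show m₂ - s - 2 + s = m₂ - 2 by omega, show j + 1 - m₁ - (m₂ - s - 2) = 1 by omega,
    show m₂ - s - (m₂ - s - 2) = 2 by omega, hgE, hgf]
  have cB : ((m₂ - s - 1 : ℕ) : ℚ) = (m₂ : ℚ) - s - 1 := by
    rw [Nat.cast_sub (by omega), Nat.cast_sub (by omega)]
    push_cast
    ring
  rw [cB]
  push_cast
  field_simp

/-- **The corner column `(#A − 1, #B − 1, s)`** (`m₁ + m₂ − s = j + 2`, `s + 2 ≤ m₁, m₂`) sums to `twoK`. -/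
theorem col_corner3 {n j m₁ m₂ s : ℕ} (hm₁j : m₁ ≤ j) (hm₂j : m₂ ≤ j) (hn : 2 * j + 1 ≤ n) (hs₁ : s + 2 ≤ m₁)
    (hs₂ : s + 2 ≤ m₂) (hsum : m₁ + m₂ - s = j + 2) :
    ((m₁ - s - 1 : ℕ) : ℚ) * w3A n j m₁ m₂ s (m₁ - s - 1 - 1) (m₂ - s - 1) s +
      ((m₂ - s - 1 : ℕ) : ℚ) * w3B n j m₁ m₂ s (m₁ - s - 1) (m₂ - s - 1 - 1) s +
      (s : ℚ) * w3D n j m₁ m₂ s (m₁ - s - 1) (m₂ - s - 1) (s - 1) +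
      ((j : ℚ) + 1 - ((m₁ - s - 1 : ℕ) : ℚ) - ((m₂ - s - 1 : ℕ) : ℚ) - s) * w3R n j m₁ m₂ s (m₁ - s - 1) (m₂ - s - 1) s =
      twoK n j m₁ m₂ := by
  have hcol := sup3_col (n := n) (j := j) (m₁ := m₁) (m₂ := m₂) (a' := m₁ - s - 1) (b' := m₂ - s - 1) (d' := s)
    (by omega) hm₁j (by omega) hm₂j hn (by omega) (by omega)
  have hrow := sup3_row (n := n) (j := j) (m₁ := m₁) (m₂ := m₂) (s := s) (a := m₁ - s - 1) (b := m₂ - s - 1) (d := s)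
    (by omega) hm₁j (by omega) hm₂j hn (by omega) (by omega) (by omega) (by omega)
  have hβ := gBeta_corner (n := n) (j := j) (m₁ := m₁) (m₂ := m₂) (s := s) (by omega) hm₁j hm₂j hn (by omega) hs₂ hsum
  have hβ' := gBeta_corner (n := n) (j := j) (m₁ := m₂) (m₂ := m₁) (s := s) (by omega) hm₂j hm₁j hn (by omega) hs₁
    (by omega)
  have c1 : ((m₁ - s - 1 : ℕ) : ℚ) = (m₁ : ℚ) - s - 1 := by
    rw [Nat.cast_sub (by omega), Nat.cast_sub (by omega)]; push_cast; ring
  have c2 : ((m₂ - s - 1 : ℕ) : ℚ) = (m₂ : ℚ) - s - 1 := by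
    rw [Nat.cast_sub (by omega), Nat.cast_sub (by omega)]; push_cast; ring
  have cA : ((m₁ - s : ℕ) : ℚ) = (m₁ : ℚ) - s := by rw [Nat.cast_sub (by omega)]
  have cB : ((m₂ - s : ℕ) : ℚ) = (m₂ : ℚ) - s := by rw [Nat.cast_sub (by omega)]
  have hsumq : (m₁ : ℚ) + m₂ - s = (j : ℚ) + 2 := by
    have : ((m₁ + m₂ - s : ℕ) : ℚ) = (j : ℚ) + 2 := by exact_mod_cast hsum
    rw [Nat.cast_sub (by omega)] at this
    push_cast at this
    linarith
  have hD : (n : ℚ) - j - 2 ≠ 0 := by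
    have : (j : ℚ) + 3 ≤ n := by exact_mod_cast (show j + 3 ≤ n by omega)
    linarith
  have hρ : ((n - m₁ - m₂ + s : ℕ) : ℚ) = (n : ℚ) - j - 2 := by
    rw [show n - m₁ - m₂ + s = n - (j + 2) by omega, Nat.cast_sub (by omega)]
    push_cast
    ring
  -- the indices
  have e1 : m₁ - s - 1 - 1 + s = m₁ - 2 := by omega
  have e2 : m₂ - s - 1 + s = m₂ - 1 := by omega
  have e3 : m₁ - s - 1 + s = m₁ - 1 := by omega
  have e4 : m₂ - s - 1 - 1 + s = m₂ - 2 := by omega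
  have e5 : m₁ - s - 1 - 1 = m₁ - s - 2 := by omega
  have e6 : m₂ - s - 1 - 1 = m₂ - s - 2 := by omega
  rw [e1, e2, e3, e4] at hcol
  rw [e3, e2] at hrow
  -- the weights
  have hA : w3A n j m₁ m₂ s (m₁ - s - 1 - 1) (m₂ - s - 1) s =
      supA n j m₁ m₂ (m₁ - 2) (m₂ - 1) + gBeta n j m₂ m₁ s (m₁ - s - 2) := by
    unfold w3A
    split_ifs <;> first | (exfalso; omega) | (rw [e1, e5])
  have hB : w3B n j m₁ m₂ s (m₁ - s - 1) (m₂ - s - 1 - 1) s =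
      supB n j m₁ m₂ (m₁ - 1) (m₂ - 2) + gBeta n j m₁ m₂ s (m₂ - s - 2) := by
    unfold w3B
    split_ifs <;> first | (exfalso; omega) | (rw [e4, e6])
  have hR : w3R n j m₁ m₂ s (m₁ - s - 1) (m₂ - s - 1) s = gCornerR n j m₁ m₂ s := by
    unfold w3R
    rw [if_pos ⟨by omega, by omega, rfl⟩]
  rw [hA, hB, hR, coef_w3D (by omega) (by omega)]
  have hcoef : (j : ℚ) + 1 - ((m₁ - s - 1 : ℕ) : ℚ) - ((m₂ - s - 1 : ℕ) : ℚ) - s = 1 := by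
    rw [c1, c2]
    linarith
  rw [hcoef] at hcol ⊢
  have hrowc : supA n j m₁ m₂ (m₁ - 1) (m₂ - 1) + supB n j m₁ m₂ (m₁ - 1) (m₂ - 1) +
      ((n : ℚ) - j - 2) * supR n j m₁ m₂ (m₁ - 1) (m₂ - 1) = 1 := by
    rw [c1, c2, cA, cB] at hrow
    linear_combination hrow
  have hsupR : supR n j m₁ m₂ (m₁ - 1) (m₂ - 1) =
      (1 - supA n j m₁ m₂ (m₁ - 1) (m₂ - 1) - supB n j m₁ m₂ (m₁ - 1) (m₂ - 1)) / ((n : ℚ) - j - 2) := by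
    rw [eq_div_iff hD]
    linear_combination hrowc
  unfold gCornerR
  rw [hρ]
  have hm₁0 : (m₁ : ℚ) ≠ 0 := by
    have : (2 : ℚ) ≤ m₁ := by exact_mod_cast (show 2 ≤ m₁ by omega)
    linarith
  have hm₂0 : (m₂ : ℚ) ≠ 0 := by
    have : (2 : ℚ) ≤ m₂ := by exact_mod_cast (show 2 ≤ m₂ by omega)
    linarith
  rw [hsupR] at hcol
  rw [mul_add, mul_add, hβ, hβ']
  linear_combination hcol

/-- **The corner column when `m₁ + m₂ − s = j + 3`**: both corrections vanish. -/
theorem col_corner3_three {n j m₁ m₂ s : ℕ} (hm₁j : m₁ ≤ j) (hm₂j : m₂ ≤ j) (hn : 2 * j + 1 ≤ n) (hs₁ : s + 2 ≤ m₁)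
    (hs₂ : s + 2 ≤ m₂) (hsum : m₁ + m₂ - s = j + 3) :
    ((m₁ - s - 1 : ℕ) : ℚ) * w3A n j m₁ m₂ s (m₁ - s - 1 - 1) (m₂ - s - 1) s +
      ((m₂ - s - 1 : ℕ) : ℚ) * w3B n j m₁ m₂ s (m₁ - s - 1) (m₂ - s - 1 - 1) s +
      (s : ℚ) * w3D n j m₁ m₂ s (m₁ - s - 1) (m₂ - s - 1) (s - 1) +
      ((j : ℚ) + 1 - ((m₁ - s - 1 : ℕ) : ℚ) - ((m₂ - s - 1 : ℕ) : ℚ) - s) * w3R n j m₁ m₂ s (m₁ - s - 1) (m₂ - s - 1) s =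
      twoK n j m₁ m₂ := by
  have hcol := sup3_col (n := n) (j := j) (m₁ := m₁) (m₂ := m₂) (a' := m₁ - s - 1) (b' := m₂ - s - 1) (d' := s)
    (by omega) hm₁j (by omega) hm₂j hn (by omega) (by omega)
  have c1 : ((m₁ - s - 1 : ℕ) : ℚ) = (m₁ : ℚ) - s - 1 := by
    rw [Nat.cast_sub (by omega), Nat.cast_sub (by omega)]; push_cast; ring
  have c2 : ((m₂ - s - 1 : ℕ) : ℚ) = (m₂ : ℚ) - s - 1 := by
    rw [Nat.cast_sub (by omega), Nat.cast_sub (by omega)]; push_cast; ring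
  have hsumq : (m₁ : ℚ) + m₂ - s = (j : ℚ) + 3 := by
    have : ((m₁ + m₂ - s : ℕ) : ℚ) = (j : ℚ) + 3 := by exact_mod_cast hsum
    rw [Nat.cast_sub (by omega)] at this
    push_cast at this
    linarith
  have hcoef : (j : ℚ) + 1 - ((m₁ - s - 1 : ℕ) : ℚ) - ((m₂ - s - 1 : ℕ) : ℚ) - s = 0 := by
    rw [c1, c2]
    linarith
  rw [hcoef] at hcol ⊢
  have e1 : m₁ - s - 1 - 1 + s = m₁ - 2 := by omega
  have e2 : m₂ - s - 1 + s = m₂ - 1 := by omega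
  have e3 : m₁ - s - 1 + s = m₁ - 1 := by omega
  have e4 : m₂ - s - 1 - 1 + s = m₂ - 2 := by omega
  rw [e1, e2, e3, e4] at hcol
  have hA : w3A n j m₁ m₂ s (m₁ - s - 1 - 1) (m₂ - s - 1) s = supA n j m₁ m₂ (m₁ - 2) (m₂ - 1) := by
    unfold w3A
    split_ifs <;> first | (exfalso; omega) | (rw [gBeta_eq_zero (by omega), add_zero, e1])
  have hB : w3B n j m₁ m₂ s (m₁ - s - 1) (m₂ - s - 1 - 1) s = supB n j m₁ m₂ (m₁ - 1) (m₂ - 2) := by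
    unfold w3B
    split_ifs <;> first | (exfalso; omega) | (rw [gBeta_eq_zero (by omega), add_zero, e4])
  rw [hA, hB, coef_w3D (by omega) (by omega)]
  linear_combination hcol

/-- **The column `(#A, #B, s − 1)`** (`1 ≤ s`, `m₁ + m₂ − s = j + 2`): both corrections vanish. -/
theorem col_typeII_end {n j m₁ m₂ s : ℕ} (hm₁j : m₁ ≤ j) (hm₂j : m₂ ≤ j) (hn : 2 * j + 1 ≤ n) (hs : 1 ≤ s)
    (hs₁ : s + 1 ≤ m₁) (hs₂ : s + 1 ≤ m₂) (hsum : m₁ + m₂ - s = j + 2) :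
    ((m₁ - s : ℕ) : ℚ) * w3A n j m₁ m₂ s (m₁ - s - 1) (m₂ - s) (s - 1) +
      ((m₂ - s : ℕ) : ℚ) * w3B n j m₁ m₂ s (m₁ - s) (m₂ - s - 1) (s - 1) +
      ((s - 1 : ℕ) : ℚ) * w3D n j m₁ m₂ s (m₁ - s) (m₂ - s) (s - 1 - 1) +
      ((j : ℚ) + 1 - ((m₁ - s : ℕ) : ℚ) - ((m₂ - s : ℕ) : ℚ) - ((s - 1 : ℕ) : ℚ)) * w3R n j m₁ m₂ s (m₁ - s) (m₂ - s) (s - 1) =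
      twoK n j m₁ m₂ := by
  have hcol := sup3_col (n := n) (j := j) (m₁ := m₁) (m₂ := m₂) (a' := m₁ - s) (b' := m₂ - s) (d' := s - 1)
    (by omega) hm₁j (by omega) hm₂j hn (by omega) (by omega)
  have cA : ((m₁ - s : ℕ) : ℚ) = (m₁ : ℚ) - s := by rw [Nat.cast_sub (by omega)]
  have cB : ((m₂ - s : ℕ) : ℚ) = (m₂ : ℚ) - s := by rw [Nat.cast_sub (by omega)]
  have cs : ((s - 1 : ℕ) : ℚ) = (s : ℚ) - 1 := by rw [Nat.cast_sub hs]; push_cast; ring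
  have hsumq : (m₁ : ℚ) + m₂ - s = (j : ℚ) + 2 := by
    have : ((m₁ + m₂ - s : ℕ) : ℚ) = (j : ℚ) + 2 := by exact_mod_cast hsum
    rw [Nat.cast_sub (by omega)] at this
    push_cast at this
    linarith
  have hcoef : (j : ℚ) + 1 - ((m₁ - s : ℕ) : ℚ) - ((m₂ - s : ℕ) : ℚ) - ((s - 1 : ℕ) : ℚ) = 0 := by
    rw [cA, cB, cs]
    linarith
  rw [hcoef] at hcol ⊢
  have e1 : m₁ - s - 1 + (s - 1) = m₁ - 2 := by omega
  have e2 : m₂ - s + (s - 1) = m₂ - 1 := by omega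
  have e3 : m₁ - s + (s - 1) = m₁ - 1 := by omega
  have e4 : m₂ - s - 1 + (s - 1) = m₂ - 2 := by omega
  have e5 : m₁ - s - 1 + s - 1 = m₁ - 2 := by omega
  have e6 : m₂ - s - 1 + s - 1 = m₂ - 2 := by omega
  rw [e1, e2, e3, e4] at hcol
  have hA : w3A n j m₁ m₂ s (m₁ - s - 1) (m₂ - s) (s - 1) = supA n j m₁ m₂ (m₁ - 2) (m₂ - 1) := by
    unfold w3A
    split_ifs <;> first | (exfalso; omega) | (rw [gBeta_eq_zero (by omega), add_zero, e5])
  have hB : w3B n j m₁ m₂ s (m₁ - s) (m₂ - s - 1) (s - 1) = supB n j m₁ m₂ (m₁ - 1) (m₂ - 2) := by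
    unfold w3B
    split_ifs <;> first | (exfalso; omega) | (rw [gBeta_eq_zero (by omega), add_zero, e6])
  rw [hA, hB, coef_w3D (by omega) (by omega)]
  linear_combination hcol

/-! ### The column identity on every realisable profile -/

/-- **THE COLUMN IDENTITY**: every realisable untouched column `(a', b', d')` sums to `twoK`. -/
theorem w3_col {n j m₁ m₂ s : ℕ} (hm₁ : 1 ≤ m₁) (hm₁j : m₁ ≤ j) (hm₂ : 1 ≤ m₂) (hm₂j : m₂ ≤ j)
    (hs₁ : s + 2 ≤ m₁) (hs₂ : s + 2 ≤ m₂) (hbig : j + 2 ≤ m₁ + m₂ - s) (hn : 2 * j + 1 ≤ n) (a' b' d' : ℕ)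
    (ha : a' ≤ m₁ - s) (hb : b' ≤ m₂ - s) (hd : d' ≤ s) (h1 : ¬ (a' = m₁ - s ∧ d' = s))
    (h2 : ¬ (b' = m₂ - s ∧ d' = s)) (hab : a' + b' + d' ≤ j + 1) :
    (a' : ℚ) * w3A n j m₁ m₂ s (a' - 1) b' d' + (b' : ℚ) * w3B n j m₁ m₂ s a' (b' - 1) d' +
      (d' : ℚ) * w3D n j m₁ m₂ s a' b' (d' - 1) + ((j : ℚ) + 1 - a' - b' - d') * w3R n j m₁ m₂ s a' b' d' =
      twoK n j m₁ m₂ := by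
  -- the mirror instance, used for the cases of `C₂`
  have hmirror :
      (b' : ℚ) * w3A n j m₂ m₁ s (b' - 1) a' d' + (a' : ℚ) * w3B n j m₂ m₁ s b' (a' - 1) d' +
        (d' : ℚ) * w3D n j m₂ m₁ s b' a' (d' - 1) + ((j : ℚ) + 1 - b' - a' - d') * w3R n j m₂ m₁ s b' a' d' =
        twoK n j m₂ m₁ →
      (a' : ℚ) * w3A n j m₁ m₂ s (a' - 1) b' d' + (b' : ℚ) * w3B n j m₁ m₂ s a' (b' - 1) d' +
        (d' : ℚ) * w3D n j m₁ m₂ s a' b' (d' - 1) + ((j : ℚ) + 1 - a' - b' - d') * w3R n j m₁ m₂ s a' b' d' =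
        twoK n j m₁ m₂ := by
    intro h
    rw [w3A_symm n j m₁ m₂ s (a' - 1) b' d', w3B_symm n j m₁ m₂ s a' (b' - 1) d', w3D_symm n j m₁ m₂ s a' b' (d' - 1),
      w3R_symm n j m₁ m₂ s a' b' d', twoK_symm]
    linear_combination h
  by_cases hI : a' + 1 = m₁ - s ∧ d' = s
  · have ha' : a' = m₁ - s - 1 := by omega
    subst ha'
    rw [hI.2]
    by_cases hI' : b' + 1 = m₂ - s
    · have hb' : b' = m₂ - s - 1 := by omega
      subst hb'
      rcases Nat.eq_or_lt_of_le hbig with hsum | hsum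
      · exact col_corner3 hm₁j hm₂j hn hs₁ hs₂ hsum.symm
      · exact col_corner3_three hm₁j hm₂j hn hs₁ hs₂ (by omega)
    · exact col_typeI hm₁ hm₁j hm₂ hm₂j hn (by omega) (by omega) (by omega) (by omega)
  by_cases hI' : b' + 1 = m₂ - s ∧ d' = s
  · have hb' : b' = m₂ - s - 1 := by omega
    subst hb'
    apply hmirror
    rw [hI'.2]
    exact col_typeI hm₂ hm₂j hm₁ hm₁j hn (by omega) (by omega) (by omega) (by omega)
  by_cases hII : a' = m₁ - s ∧ d' + 1 = s
  · have ha' : a' = m₁ - s := hII.1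
    have hd' : d' = s - 1 := by omega
    subst ha' hd'
    by_cases hbB : b' = m₂ - s
    · subst hbB
      exact col_typeII_end hm₁j hm₂j hn (by omega) (by omega) (by omega) (by omega)
    · exact col_typeII hm₁ hm₁j hm₂ hm₂j hn (by omega) (by omega) (by omega) (by omega) (by omega)
  by_cases hII' : b' = m₂ - s ∧ d' + 1 = s
  · have hb' : b' = m₂ - s := hII'.1
    have hd' : d' = s - 1 := by omega
    subst hb' hd'
    apply hmirror
    by_cases haA : a' = m₁ - s
    · subst haA
      exact col_typeII_end hm₂j hm₁j hn (by omega) (by omega) (by omega) (by omega)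
    · exact col_typeII hm₂ hm₂j hm₁ hm₁j hn (by omega) (by omega) (by omega) (by omega) (by omega)
  · -- the interior
    have hcol := sup3_col (n := n) (j := j) (m₁ := m₁) (m₂ := m₂) (a' := a') (b' := b') (d' := d')
      hm₁ hm₁j hm₂ hm₂j hn (by omega) (by omega)
    rw [coef_w3A h1 (by omega) (by omega), coef_w3B h2 (by omega) (by omega), coef_w3D h1 h2,
      w3R_sup (by omega) (by omega) (by omega) (by omega)]
    exact hcol

/-- **The touched columns of `C₁`**: `#A·w3A (#A − 1) b' s + s·w3D #A b' (s − 1) = twoK` (`b' < #B`). -/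
theorem w3_top₁ {n j m₁ m₂ s : ℕ} (hm₁ : 1 ≤ m₁) (hs₁ : s + 1 ≤ m₁) (b' : ℕ) (hb : b' < m₂ - s) :
    ((m₁ - s : ℕ) : ℚ) * w3A n j m₁ m₂ s (m₁ - s - 1) b' s + (s : ℚ) * w3D n j m₁ m₂ s (m₁ - s) b' (s - 1) =
      twoK n j m₁ m₂ := by
  have hA : w3A n j m₁ m₂ s (m₁ - s - 1) b' s =
      supA n j m₁ m₂ (m₁ - 1) (b' + s) - gErr n j m₁ m₂ s b' / (m₁ : ℚ) := by
    unfold w3A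
    rw [if_pos ⟨by omega, rfl⟩]
  have hD : (s : ℚ) * w3D n j m₁ m₂ s (m₁ - s) b' (s - 1) =
      (s : ℚ) * (supD n j m₁ m₂ (m₁ - 1) (b' + s - 1) - gErr n j m₁ m₂ s b' / (m₁ : ℚ)) := by
    rcases Nat.eq_zero_or_pos s with h0 | hpos
    · subst h0
      simp
    · unfold w3D
      rw [if_pos ⟨rfl, by omega, by omega⟩]
  rw [hA, hD]
  have hm : (m₁ : ℚ) ≠ 0 := by
    have : (1 : ℚ) ≤ m₁ := by exact_mod_cast hm₁
    linarith
  unfold gErr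
  rw [Nat.cast_sub (show s ≤ m₁ by omega)]
  field_simp
  ring

/-- **The touched columns of `C₂`**: `#B·w3B a' (#B − 1) s + s·w3D a' #B (s − 1) = twoK` (`a' < #A`). -/
theorem w3_top₂ {n j m₁ m₂ s : ℕ} (hm₂ : 1 ≤ m₂) (hs₂ : s + 1 ≤ m₂) (a' : ℕ) (ha : a' < m₁ - s) :
    ((m₂ - s : ℕ) : ℚ) * w3B n j m₁ m₂ s a' (m₂ - s - 1) s + (s : ℚ) * w3D n j m₁ m₂ s a' (m₂ - s) (s - 1) =
      twoK n j m₁ m₂ := by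
  rw [w3B_symm, w3D_symm, twoK_symm]
  exact w3_top₁ hm₂ hs₂ a' ha

end PercRepro.PuncturedLYM
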